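import Literature.NumberTheory.LFunctions.BurnolEvaluatorProofs
import HarnessLib

/-!
# Burnol 2004 (JTNB), Prop. 6.6 from Prop. 6.2: "the `Z^a_{ρ,k}` are the orthogonal projections to
# `K_a` of the vectors `Y^a_{ρ,k}` in `L_a`" — completeness descends along the projection

LINE 1 — LABEL: RH-FREE (Hilbert-space bookkeeping in Burnol's Sonine spaces `K_a ⊂ L_a ⊂ L²`; the
systems are indexed by the non-trivial zeros of `ζ` WHEREVER they lie; no hypothesis and no conclusion
about their location). FRAMING (cell rh-crit, D-0074): corpus theorems are RH-FREE literature; nothing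
here is worded as progress toward RH. bears_on: B-C/B-P (LADDER-RH COLUMN 6, de Branges framework).
WHAT THIS IS NOT: not a route, not a criterion, no positivity; completeness of an evaluator system in a
Sonine space fixes corpus vocabulary and moves RH by nothing. Nothing here bears on the truth of RH.

Source: J.-F. Burnol, *Two complete and minimal systems associated with the zeros of the Riemann zeta
function*, J. Théor. Nombres Bordeaux 16 (2004) 65–94 = arXiv:math/0203120v7 [Burnol2004b], §6,
Prop. 6.6 and its one-line printed proof (TeX of record `dbl/src/Burnol2004JTNB_arXivmath0203120v7.tex`,
l.1330–1338):

> "Let `a > 1`. The vectors `Z^a_{ρ,k}` span `K_a` even after omitting arbitrarily finitely many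
> among them. *Proof.* They are the orthogonal projections to `K_a` of the vectors `Y^a_{ρ,k}` in
> `L_a`."

— the omission-completeness of the `Y^a_{ρ,k}` in `L_a` being Prop. 6.2 (`Burnol2004b_prop6_2`, a
named fact of `BurnolZetaSystems.lean`, Kreĭn's theorem in print). This theorem-only module (0
definitions, 0 named facts) PROVES the printed deduction:

* `BurnolProjection.mem_closure_span_range_of_inner_sub_eq_zero` — the abstract Hilbert-space step:
  if `K` is a linear subset, every `v i` lies in `K` and every `u i − v i` is orthogonal to `K`, then
  any `f ∈ K` in the closed span of the `u i` lies in the closed span of the `v i` (same coefficients: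
  `‖f − Σ cᵢ vᵢ‖ ≤ ‖f − Σ cᵢ uᵢ‖`, since `f − Σ cᵢ vᵢ ∈ K ⊥ Σ cᵢ (uᵢ − vᵢ)`);
* `BurnolProjection.isCompleteSystemIn_sonineK_of_sonineL` — for `0 < a` and ANY sub-family of
  indices: completeness of the `Y^a_{ρ,k}` in `L_a` implies completeness of the `Z^a_{ρ,k}` in `K_a`
  (the projection relation `Y^a_{ρ,k} − Z^a_{ρ,k} ⊥ K_a` is the tree theorem
  `BurnolEvaluators.inner_burnolYSystem_sub_burnolZSystem`, `BurnolEvaluatorProofs.lean`);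
* `Burnol2004b_prop6_6_of_prop6_2 : Burnol2004b_prop6_2 → Burnol2004b_prop6_6` — Prop. 6.6 AS TYPED
  from Prop. 6.2 AS TYPED; `Burnol2004b_prop6_6_holds` is then one line once `Burnol2004b_prop6_2`
  is discharged (not here).

Deviation from print: none (the printed sentence is exactly the projection argument; we spell out the
elementary norm inequality instead of invoking the orthogonal projector of `L²` onto the closed
subspace `K_a`).

## References
* [Burnol2004b] §6 Prop. 6.6 (TeX l.1330–1338), Prop. 6.2 (l.1241–1257), §2 l.481–484 ("The vectors
  `Z^a_{w,k}` in `K_a` are the orthogonal projections from `L_a` to `K_a` of the evaluators `Y^a_{w,k}`").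
-/

noncomputable section

open MeasureTheory Complex Filter Set
open scoped ComplexConjugate Topology InnerProductSpace

namespace Literature.NumberTheory.LFunctions

namespace BurnolProjection

/-! ## A. The abstract projection step -/

section Abstract

variable {ι E : Type*} [NormedAddCommGroup E] [InnerProductSpace ℂ E]

/-- Finite linear combinations of members of a linear subset stay in it. [cite: Burnol2004b, Prop. 6.6 (arXiv:math/0203120v7 p. 17, TeX l.1330–1338)] -/
theorem finsupp_sum_smul_mem {K : Set E} (h0 : (0 : E) ∈ K) (hadd : ∀ f ∈ K, ∀ g ∈ K, f + g ∈ K)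
    (hsmul : ∀ (c : ℂ), ∀ f ∈ K, c • f ∈ K) {v : ι → E} (hv : ∀ i, v i ∈ K) (c : ι →₀ ℂ) :
    (c.sum fun i a ↦ a • v i) ∈ K := by
  classical
  unfold Finsupp.sum
  induction c.support using Finset.induction_on with
  | empty => simpa using h0
  | insert i s hi ih =>
    rw [Finset.sum_insert hi]
    exact hadd _ (hsmul _ _ (hv i)) _ ih

/-- A finite linear combination of vectors orthogonal to `g` is orthogonal to `g`. [cite: Burnol2004b, Prop. 6.6 (arXiv:math/0203120v7 p. 17, TeX l.1330–1338)] -/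
theorem inner_finsupp_sum_smul_eq_zero {g : E} {w : ι → E} (hw : ∀ i, ⟪g, w i⟫_ℂ = 0)
    (c : ι →₀ ℂ) : ⟪g, c.sum fun i a ↦ a • w i⟫_ℂ = 0 := by
  classical
  unfold Finsupp.sum
  rw [inner_sum]
  refine Finset.sum_eq_zero fun i _ ↦ ?_
  rw [inner_smul_right, hw i, mul_zero]

/-- **The projection step.** Let `K` be a linear subset of an inner-product space, `u, v` two families
with every `v i ∈ K` and every `u i − v i` orthogonal to `K`. Then every `f ∈ K` lying in the closed
linear span of the `u i` lies in the closed linear span of the `v i`: with the SAME coefficients,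
`‖f − Σ cᵢvᵢ‖ ≤ ‖f − Σ cᵢuᵢ‖` because `f − Σ cᵢvᵢ ∈ K` is orthogonal to `Σ cᵢ(uᵢ − vᵢ)`. This is
Burnol's "They are the orthogonal projections to `K_a` of the vectors `Y^a_{ρ,k}` in `L_a`".
[cite: Burnol2004b, Prop. 6.6 (arXiv:math/0203120v7 p. 17, TeX l.1330–1338)] -/
theorem mem_closure_span_range_of_inner_sub_eq_zero {K : Set E} (h0 : (0 : E) ∈ K)
    (hadd : ∀ f ∈ K, ∀ g ∈ K, f + g ∈ K) (hsmul : ∀ (c : ℂ), ∀ f ∈ K, c • f ∈ K)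
    {u v : ι → E} (hv : ∀ i, v i ∈ K) (horth : ∀ i, ∀ g ∈ K, ⟪g, u i - v i⟫_ℂ = 0)
    {f : E} (hf : f ∈ K) (hfu : f ∈ closure (Submodule.span ℂ (Set.range u) : Set E)) :
    f ∈ closure (Submodule.span ℂ (Set.range v) : Set E) := by
  rw [Metric.mem_closure_iff] at hfu ⊢
  intro ε hε
  obtain ⟨x, hx, hfx⟩ := hfu ε hε
  obtain ⟨c, rfl⟩ := (Finsupp.mem_span_range_iff_exists_finsupp).1 hx
  -- the candidate with the same coefficients on the `v i`
  set y : E := c.sum fun i a ↦ a • v i with hy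
  have hyspan : y ∈ (Submodule.span ℂ (Set.range v) : Set E) :=
    Finsupp.mem_span_range_iff_exists_finsupp.2 ⟨c, rfl⟩
  refine ⟨y, hyspan, ?_⟩
  -- `f - y ∈ K`
  have hsub : ∀ f ∈ K, ∀ g ∈ K, f - g ∈ K := fun f hf g hg ↦ by
    have := hadd f hf ((-1 : ℂ) • g) (hsmul _ g hg)
    simpa [sub_eq_add_neg] using this
  have hfyK : f - y ∈ K := hsub f hf y (finsupp_sum_smul_mem h0 hadd hsmul hv c)
  -- `x - y = Σ cᵢ (uᵢ - vᵢ)` is orthogonal to `K`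
  have hxy : (c.sum fun i a ↦ a • u i) - y = c.sum fun i a ↦ a • (u i - v i) := by
    rw [hy]
    unfold Finsupp.sum
    rw [← Finset.sum_sub_distrib]
    refine Finset.sum_congr rfl fun i _ ↦ ?_
    simp only [smul_sub]
  have horth' : ⟪f - y, (c.sum fun i a ↦ a • u i) - y⟫_ℂ = 0 := by
    rw [hxy]
    exact inner_finsupp_sum_smul_eq_zero (fun i ↦ horth i _ hfyK) c
  -- `‖f - y‖² = re ⟪f - y, f - x⟫ ≤ ‖f - y‖ ‖f - x‖`
  have hdecomp : f - y = (f - c.sum fun i a ↦ a • u i) + ((c.sum fun i a ↦ a • u i) - y) := by abel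
  have hsq : ‖f - y‖ ^ 2 = RCLike.re ⟪f - y, f - c.sum fun i a ↦ a • u i⟫_ℂ := by
    have h1 : ⟪f - y, f - y⟫_ℂ =
        ⟪f - y, f - c.sum fun i a ↦ a • u i⟫_ℂ + ⟪f - y, (c.sum fun i a ↦ a • u i) - y⟫_ℂ := by
      rw [← inner_add_right, ← hdecomp]
    rw [horth', add_zero] at h1
    rw [← h1, ← inner_self_eq_norm_sq (𝕜 := ℂ)]
  have hle : ‖f - y‖ ^ 2 ≤ ‖f - y‖ * ‖f - c.sum fun i a ↦ a • u i‖ := by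
    rw [hsq]
    exact (RCLike.re_le_norm _).trans (norm_inner_le_norm _ _)
  have hle' : ‖f - y‖ ≤ ‖f - c.sum fun i a ↦ a • u i‖ := by
    by_cases h : ‖f - y‖ = 0
    · rw [h]; exact norm_nonneg _
    · have hpos : 0 < ‖f - y‖ := lt_of_le_of_ne (norm_nonneg _) (Ne.symm h)
      rw [pow_two] at hle
      exact le_of_mul_le_mul_left hle hpos
  calc dist f y = ‖f - y‖ := dist_eq_norm f y
    _ ≤ ‖f - c.sum fun i a ↦ a • u i‖ := hle'
    _ = dist f (c.sum fun i a ↦ a • u i) := (dist_eq_norm _ _).symm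
    _ < ε := hfx

/-- Completeness descends along the projection: under the hypotheses of
`mem_closure_span_range_of_inner_sub_eq_zero`, if `K ⊆ S` and the family `u` is complete in `S`, then
the family `v` is complete in `K`. [cite: Burnol2004b, Prop. 6.6 (arXiv:math/0203120v7 p. 17, TeX l.1330–1338)] -/
theorem isCompleteSystemIn_of_inner_sub_eq_zero {K S : Set E} (hKS : K ⊆ S) (h0 : (0 : E) ∈ K)
    (hadd : ∀ f ∈ K, ∀ g ∈ K, f + g ∈ K) (hsmul : ∀ (c : ℂ), ∀ f ∈ K, c • f ∈ K)
    {u v : ι → E} (hv : ∀ i, v i ∈ K) (horth : ∀ i, ∀ g ∈ K, ⟪g, u i - v i⟫_ℂ = 0)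
    (hu : IsCompleteSystemIn S u) : IsCompleteSystemIn K v :=
  ⟨hv, fun _ hf ↦ mem_closure_span_range_of_inner_sub_eq_zero h0 hadd hsmul hv horth hf
    (hu.2 (hKS hf))⟩

end Abstract

/-! ## B. From `L_a` to `K_a` along `Y^a_{ρ,k} − Z^a_{ρ,k} ⊥ K_a` -/

/-- For `0 < a` and any set of indices: if the evaluators `Y^a_{ρ,k}` (restricted to these indices) are
complete in `L_a`, then the evaluators `Z^a_{ρ,k}` (same indices) are complete in `K_a` — "They are
the orthogonal projections to `K_a` of the vectors `Y^a_{ρ,k}` in `L_a`".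
[cite: Burnol2004b, Prop. 6.6 (arXiv:math/0203120v7 p. 17, TeX l.1330–1338)] -/
theorem isCompleteSystemIn_sonineK_of_sonineL {a : ℝ} (ha : 0 < a) {ι : Type*}
    (e : ι → ZetaZeroIndex)
    (hY : IsCompleteSystemIn (sonineL a) (fun i ↦ burnolYSystem a (e i))) :
    IsCompleteSystemIn (sonineK a) (fun i ↦ burnolZSystem a (e i)) :=
  isCompleteSystemIn_of_inner_sub_eq_zero (sonineK_subset_sonineL a) (zero_mem_sonineK a)
    (fun _ hf _ hg ↦ add_mem_sonineK hf hg) (fun c _ hf ↦ smul_mem_sonineK c hf)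
    (fun i ↦ BurnolEvaluators.burnolZSystem_mem_sonineK ha (e i))
    (fun i _ hg ↦ BurnolEvaluators.inner_burnolYSystem_sub_burnolZSystem ha (e i) hg) hY

/-- The full systems: completeness of `(Y^a_{ρ,k})` in `L_a` gives completeness of `(Z^a_{ρ,k})` in
`K_a` (`0 < a`). [cite: Burnol2004b, §2 and Prop. 6.6 (arXiv:math/0203120v7 pp. 5, 17; TeX l.481–484, 1330–1338)] -/
theorem isCompleteSystemIn_sonineK_burnolZSystem_of_burnolYSystem {a : ℝ} (ha : 0 < a)
    (hY : IsCompleteSystemIn (sonineL a) (burnolYSystem a)) :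
    IsCompleteSystemIn (sonineK a) (burnolZSystem a) :=
  isCompleteSystemIn_sonineK_of_sonineL ha id hY

end BurnolProjection

/-! ## C. Prop. 6.6 from Prop. 6.2 -/

/-- **Burnol 2004b, Prop. 6.6 from Prop. 6.2** (the printed proof: "They are the orthogonal
projections to `K_a` of the vectors `Y^a_{ρ,k}` in `L_a`"): for `a > 1`, the omission-completeness of
the `Y^a_{ρ,k}` in `L_a` (Prop. 6.2, second clause) descends to the omission-completeness of the
`Z^a_{ρ,k}` in `K_a`. [cite: Burnol2004b, Prop. 6.6 (arXiv:math/0203120v7 p. 17, TeX l.1330–1338)] -/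
theorem Burnol2004b_prop6_6_of_prop6_2 (h62 : Burnol2004b_prop6_2) : Burnol2004b_prop6_6 := by
  intro a ha S
  have ha0 : 0 < a := lt_trans zero_lt_one ha
  exact BurnolProjection.isCompleteSystemIn_sonineK_of_sonineL ha0
    (fun p : {p : ZetaZeroIndex // p ∉ S} ↦ p.1) ((h62 a ha).2 S)

end Literature.NumberTheory.LFunctions
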